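import Literature.Analysis.FluidPDE.PassiveVectorTensorCubeDescentDecay
import Literature.Analysis.FluidPDE.PassiveVectorTensorPropagatorWeightedDecayAdjoint
import Literature.Analysis.FluidPDE.PassiveVectorTensorPropagatorUnique
import HarnessLib

/-!
# BAND KILL for window propagators of the tensor passive-vector problem: data with no low modes are damped
# exponentially, up to the leakage of the descent ladder

Analysis/FluidPDE file (pure proof layer; no definitions, no named facts).  For an `IsPropagator T b 𝔸 U` family with
`NearIso 𝔸 lo hi`, `0 < lo`, a bounded carrier whose slices are a.e. weakly divergence free, continuous, `Λ`-Lipschitz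
(`‖b x − b y‖ ≤ Λ‖reprc(x−y)‖`) and within `W n` (sup norm) of their Fourier truncations at radius `n S − 2Δ`
(`n ≤ J+1`), a ladder `K₀, S, Δ, J` (`2Δ ≤ S`, `J S ≤ K₀`) satisfying the LADDER CONDITION on the window
`4π (K₀ + 2Δ) (s′−s) x (2d²Λ/Δ + d Σ_{n ≤ J} W(n+1) x^{n+1}) ≤ 1`, and `L' ≤ K₀ − J S`:

* `IsPropagator.bandKill_of_divFree`, `IsPropagator.bandKill` — for every `y ∈ L²` whose Fourier coefficients vanish on the
  ladder box `‖k‖_∞ ≤ K₀ + S + 2Δ`: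
  (i) `Σ_{|k| ≤ L'} |𝓕(U(s,s′) y)(k)|² ≤ x^{−2(J+1)} ‖y‖²` (LEAKAGE below `L'`),
  (ii) `‖U(s,s′) y‖² ≤ (e^{−8π² lo L'² (s′−s)} + x^{−2(J+1)}) ‖y‖²` (DAMPING above `L'`).

Mechanism: the chosen weak solution on the window (`windowSol`) represents `U` (`IsPropagator.repr`); along it the flat
bounds `IsWeakTensorPassiveVectorOn.ae_integral_norm_sq_le_exp_add_leak` (`PassiveVectorTensorCubeDescentDecay`) hold
for a.e. time; the endpoint is reached through weak continuity (`IsPropagator.continuousOn`) tested against `U(s,s′)y`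
(energy) and against the truncation `realTrigPoly (freqBall L') 𝓕(U(s,s′)y)` (low modes); general data through the Leray
projection (`apply_eq_apply_starProjection`, `norm_mFourierCoeff_starProjection_le`).  The adjoint `U(s,s′)†` is the
propagator of the reversed problem (`IsPropagator.adjoint_eq`) and obeys the same bounds
(`PassiveVectorTensorPropagatorBandKillAdjoint`).  Consumer: cell `ad-ideate`, K1L_D `stmt-AnomalousDissipation-27980`,
W3-E (ii) `stub_effectiveFrameEnergyL_bandKill` (band kill (ii-in)/(ii-out) of the frozen-frame propagator, F-k3l-7).
## Mathlib / tree search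
Tree: `PassiveVectorTensorPropagator` (`IsPropagator`, `windowSol`, `windowSol_spec`), `PassiveVectorTensorPropagatorEnergy`
(`le_on_Icc_of_ae_le_of_continuousOn₂`), `PassiveVectorTensorPropagatorWeightedDecay` (the template; its `L²` helpers are
private, re-proved here), `PassiveVectorTensorPropagatorDuality` (`memLp_top_stLift_reversed_window`),
`PassiveScalarForcedTrace.ae_restrict_Ioo_comp_add_left`, `DivFreeProjectionFourier`, `TorusTrigPoly`
(`integral_inner_realTrigPoly_right`, `integral_norm_sq_realTrigPoly`), `TorusVectorParseval.mFourierCoeff_congr_ae`.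
Mathlib: `Real.sum_mul_le_sqrt_mul_sqrt`, `MeasureTheory.L2.inner_def`, `Lp.toLp_coeFn`.
## References
* R. Temam, *Navier–Stokes Equations* (1984), Ch. III §1 Lemma 1.2. [`Temam1984`]
* R. J. DiPerna, P.-L. Lions, Invent. Math. 98 (1989), §II.1 Lemma II.1. [`DiPernaLions1989`]
* L. Grafakos, *Classical Fourier Analysis* (3rd ed., 2014), Prop. 3.2.7. [`Grafakos2014`] -/

noncomputable section

open MeasureTheory Set Filter Complex UnitAddTorus Function Finset
open scoped ENNReal InnerProductSpace ComplexConjugate Topology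

namespace Literature.Analysis.FluidPDE

namespace Torus

variable {d : Type*} [Fintype d] [DecidableEq d]
variable {T : ℝ} {𝔸 : Visc4 d} {lo hi : ℝ} {b : ℝ → UnitAddTorus d → EuclideanSpace ℝ d}
variable {U : ℝ → ℝ → (Lp (EuclideanSpace ℝ d) 2 (volume : Measure (UnitAddTorus d)) →L[ℝ]
  Lp (EuclideanSpace ℝ d) 2 (volume : Measure (UnitAddTorus d)))}

omit [DecidableEq d] in
/-- `‖y‖² = ∫ ‖y x‖²` for an `L²` class. [cite: Temam1984, Ch. III §1 Lemma 1.2] -/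
theorem norm_sq_eq_integral_norm_sq (y : Lp (EuclideanSpace ℝ d) 2 (volume : Measure (UnitAddTorus d))) :
    ‖y‖ ^ 2 = ∫ x, ‖(y : UnitAddTorus d → EuclideanSpace ℝ d) x‖ ^ 2 := by
  rw [← real_inner_self_eq_norm_sq, MeasureTheory.L2.inner_def]
  exact integral_congr_ae (ae_of_all _ fun x => real_inner_self_eq_norm_sq _)

omit [DecidableEq d] in
/-- `‖toLp f‖² = ∫ ‖f x‖²`. [cite: Temam1984, Ch. III §1 Lemma 1.2] -/
theorem norm_toLp_sq_eq_integral {f : UnitAddTorus d → EuclideanSpace ℝ d} (hf : MemLp f 2 volume) :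
    ‖hf.toLp f‖ ^ 2 = ∫ x, ‖f x‖ ^ 2 := by
  rw [norm_sq_eq_integral_norm_sq]
  exact integral_congr_ae (hf.coeFn_toLp.mono fun x hx => by simp only [hx])

omit [DecidableEq d] in
/-- The shifted carrier `r ↦ b (s + r)` is essentially bounded on `(0, T − s) × 𝕋^d`. [cite: Temam1984, Ch. III §1 Lemma 1.2] -/
theorem memLp_top_stLift_shift_window
    (hb : MemLp (FunctionSpaces.Torus.stLift b) ∞ (volume.restrict (Ioo 0 T ×ˢ univ))) {s : ℝ} (hs : 0 ≤ s) :
    MemLp (FunctionSpaces.Torus.stLift (fun τ => b (s + τ))) ∞ (volume.restrict (Ioo 0 (T - s) ×ˢ univ)) := by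
  have h := memLp_top_stLift_reversed_window (T := T) (b := b) hb hs le_rfl
  have h2 := memLp_top_stLift_reversed (t₀ := T - s) h le_rfl
  have e : (fun r => -(fun r => -b (T - r)) (T - s - r)) = fun τ => b (s + τ) := by
    funext r; show - -b (T - (T - s - r)) = b (s + r); rw [neg_neg]; congr 1; ring
  rw [e] at h2
  exact h2

omit [DecidableEq d] in
/-- The `L²` pairing with a real trigonometric polynomial is the finite Fourier sum; with its own coefficients on `S` it is
the partial Parseval sum `Σ_{k∈S} ‖û(k)‖²`. [cite: Grafakos2014, Prop. 3.2.7 (3)] -/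
theorem integral_inner_realTrigPoly_self_coeff {S : Finset (d → ℤ)} (hS : ∀ k ∈ S, -k ∈ S)
    {u : UnitAddTorus d → EuclideanSpace ℝ d} (hu : MemLp u 2 volume) :
    ∫ x, ⟪u x, FunctionSpaces.Torus.realTrigPoly S
        (fun k => mFourierCoeff (FunctionSpaces.EuclideanSpace.complexify ∘ u) k) x⟫_ℝ =
      ∑ k ∈ S, ‖mFourierCoeff (FunctionSpaces.EuclideanSpace.complexify ∘ u) k‖ ^ 2 := by
  rw [FunctionSpaces.Torus.integral_inner_realTrigPoly_right hS
    (FunctionSpaces.Torus.isConjSymm_mFourierCoeff (hu.integrable one_le_two)) hu]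
  refine Finset.sum_congr rfl fun k _ => ?_
  rw [← @inner_self_eq_norm_sq ℂ]
  rfl

namespace IsPropagator

/-- **BAND KILL FOR THE WINDOW PROPAGATOR, divergence-free data.**  Carrier: bounded, with a.e. weakly divergence-free,
continuous, `Λ`-Lipschitz slices within `W n` of their Fourier truncations at radius `n S − 2Δ` (`n ≤ J + 1`); ladder
`K₀, S, Δ, J` (`2Δ ≤ S`, `J S ≤ K₀`) with the LADDER CONDITION on the window `[s, s′]`; `L' ≤ K₀ − J S`.  For a weakly
divergence-free `y ∈ L²` whose Fourier coefficients vanish on the ladder box `‖k‖_∞ ≤ K₀ + S + 2Δ`: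
(i) `Σ_{|k| ≤ L'} |𝓕(U(s,s′)y)(k)|² ≤ x^{−2(J+1)} ‖y‖²` and (ii) `‖U(s,s′)y‖² ≤ (e^{−8π² lo L'² (s′−s)} + x^{−2(J+1)}) ‖y‖²`.
[cite: Temam1984, Ch. III §1 Lemma 1.2] [cite: DiPernaLions1989, §II.1 Lemma II.1] -/
theorem bandKill_of_divFree (hU : IsPropagator T b 𝔸 U) (h𝔸 : NearIso 𝔸 lo hi) (hlo : 0 < lo)
    (hb : MemLp (FunctionSpaces.Torus.stLift b) ∞ (volume.restrict (Ioo 0 T ×ˢ univ)))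
    (hbdiv : ∀ᵐ τ ∂(volume.restrict (Ioo 0 T)), FunctionSpaces.Torus.IsWeaklyDivFree (b τ))
    (hbc : ∀ᵐ τ ∂(volume.restrict (Ioo 0 T)), Continuous (b τ))
    {Λ : ℝ} (hΛ : 0 ≤ Λ)
    (hbL : ∀ᵐ τ ∂(volume.restrict (Ioo 0 T)), ∀ x y, ‖b τ x - b τ y‖ ≤ Λ * ‖FunctionSpaces.Torus.reprc (x - y)‖)
    {K₀ S Δ J : ℕ} (hΔ : 0 < Δ) (hS : 2 * Δ ≤ S) (hJ : (J + 1) * S ≤ K₀ + S)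
    {W : ℕ → ℝ} (hW0 : ∀ n, 0 ≤ W n)
    (hW : ∀ᵐ τ ∂(volume.restrict (Ioo 0 T)), ∀ n, 1 ≤ n → n ≤ J + 1 → ∀ x,
      ‖b τ x - FunctionSpaces.Torus.fourierTruncate (n * S - 2 * Δ) (b τ) x‖ ≤ W n)
    {s s' x : ℝ} (hs : 0 ≤ s) (hss' : s < s') (hs'T : s' ≤ T) (hx : 1 ≤ x)
    (hladder : 4 * Real.pi * (K₀ + 2 * Δ) * (s' - s) * x *
      (2 * (Fintype.card d) ^ 2 * Λ / Δ + Fintype.card d * ∑ n ∈ Finset.range (J + 1), W (n + 1) * x ^ (n + 1)) ≤ 1)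
    {L' : ℕ} (hL' : L' ≤ FunctionSpaces.Torus.rungHeight K₀ S (J + 1))
    (y : Lp (EuclideanSpace ℝ d) 2 (volume : Measure (UnitAddTorus d)))
    (hy : FunctionSpaces.Torus.IsWeaklyDivFree (y : UnitAddTorus d → EuclideanSpace ℝ d))
    (hyoff : ∀ k ∈ FunctionSpaces.Torus.ladderSupp d K₀ S Δ,
      mFourierCoeff (FunctionSpaces.EuclideanSpace.complexify ∘ (y : UnitAddTorus d → EuclideanSpace ℝ d)) k = 0) :
    (∑ k ∈ FunctionSpaces.Torus.freqBall L', ‖mFourierCoeff (FunctionSpaces.EuclideanSpace.complexify ∘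
        ((U s s' y : Lp (EuclideanSpace ℝ d) 2 volume) : UnitAddTorus d → EuclideanSpace ℝ d)) k‖ ^ 2 ≤
        (x⁻¹ ^ (J + 1)) ^ 2 * ‖y‖ ^ 2) ∧
    ‖U s s' y‖ ^ 2 ≤ (Real.exp (-(8 * Real.pi ^ 2 * lo * (L' : ℝ) ^ 2 * (s' - s))) + (x⁻¹ ^ (J + 1)) ^ 2) * ‖y‖ ^ 2 := by
  classical
  have hsT : s < T := hss'.trans_le hs'T
  set τ : ℝ := s' - s with hτdef
  have hτ : 0 < τ := sub_pos.2 hss'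
  have hτT : τ ≤ T - s := by rw [hτdef]; linarith
  set ε2 : ℝ := (x⁻¹ ^ (J + 1)) ^ 2 with hε2
  set ρ : ℝ := 8 * Real.pi ^ 2 * lo * (L' : ℝ) ^ 2 with hρ
  have hε20 : 0 ≤ ε2 := sq_nonneg _
  have hym : MemLp (y : UnitAddTorus d → EuclideanSpace ℝ d) 2 volume := Lp.memLp y
  set w := windowSol h𝔸 hlo hb hbdiv hs hsT hym hy with hwdef
  have hsol := windowSol_spec h𝔸 hlo hb hbdiv hs hsT hym hy
  -- the shifted carrier
  have hb' := memLp_top_stLift_shift_window (T := T) hb hs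
  have hbc' : ∀ᵐ r ∂(volume.restrict (Ioo 0 (T - s))), Continuous (b (s + r)) :=
    ae_restrict_Ioo_comp_add_left (P := fun t => Continuous (b t)) hbc hs (by linarith)
  have hbL' : ∀ᵐ r ∂(volume.restrict (Ioo 0 (T - s))), ∀ x y, ‖b (s + r) x - b (s + r) y‖ ≤
      Λ * ‖FunctionSpaces.Torus.reprc (x - y)‖ :=
    ae_restrict_Ioo_comp_add_left (P := fun t => ∀ x y, ‖b t x - b t y‖ ≤ Λ * ‖FunctionSpaces.Torus.reprc (x - y)‖) hbL hs
      (by linarith)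
  have hW' : ∀ᵐ r ∂(volume.restrict (Ioo 0 (T - s))), ∀ n, 1 ≤ n → n ≤ J + 1 → ∀ x,
      ‖b (s + r) x - FunctionSpaces.Torus.fourierTruncate (n * S - 2 * Δ) (b (s + r)) x‖ ≤ W n :=
    ae_restrict_Ioo_comp_add_left (P := fun t => ∀ n, 1 ≤ n → n ≤ J + 1 → ∀ x,
      ‖b t x - FunctionSpaces.Torus.fourierTruncate (n * S - 2 * Δ) (b t) x‖ ≤ W n) hW hs (by linarith)
  -- the flat bound along `w`
  have hflat := hsol.ae_integral_norm_sq_le_exp_add_leak h𝔸 hlo hym hy hb' hΔ hS hJ hyoff hbc' hΛ hbL' hW0 hW' hτ hτT hx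
    hladder hL'
  -- representation of `U` by `w`
  have hrepr := hU.repr s hs hsT _ hym hy w hsol
  have hyLp : hym.toLp (y : UnitAddTorus d → EuclideanSpace ℝ d) = y := Lp.toLp_coeFn y hym
  have hsub : Ioo 0 τ ⊆ Ioo 0 (T - s) := Ioo_subset_Ioo le_rfl hτT
  have hE0 : (∫ z, ‖(y : UnitAddTorus d → EuclideanSpace ℝ d) z‖ ^ 2) = ‖y‖ ^ 2 := (norm_sq_eq_integral_norm_sq y).symm
  -- a.e. `r ∈ (0,τ)`: the two bounds for `U s (s+r) y`, through the representative `w r`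
  have hgood : ∀ᵐ r ∂(volume.restrict (Ioo 0 τ)), ∃ hm : MemLp (w r) 2 volume, hm.toLp (w r) = U s (s + r) y ∧
      (∑ k ∈ FunctionSpaces.Torus.freqBall L', ‖mFourierCoeff (FunctionSpaces.EuclideanSpace.complexify ∘ w r) k‖ ^ 2 ≤
        ε2 * ‖y‖ ^ 2) ∧ ‖U s (s + r) y‖ ^ 2 ≤ (Real.exp (-(ρ * r)) + ε2) * ‖y‖ ^ 2 := by
    filter_upwards [hflat, ae_restrict_of_ae_restrict_of_subset hsub hrepr] with r hr hrep
    obtain ⟨hm, he⟩ := hrep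
    rw [hyLp] at he
    refine ⟨hm, he, ?_, ?_⟩
    · rw [hE0] at hr; exact hr.1
    · have e1 : ‖U s (s + r) y‖ ^ 2 = ∫ z, ‖w r z‖ ^ 2 := by rw [← he]; exact norm_toLp_sq_eq_integral hm
      rw [e1, hρ]; rw [hE0] at hr; exact hr.2
  -- ### (ii) the energy at the endpoint, through weak continuity tested against `U s s' y`
  have hcont : ∀ z : Lp (EuclideanSpace ℝ d) 2 (volume : Measure (UnitAddTorus d)),
      ContinuousOn (fun r => ⟪U s (s + r) y, z⟫_ℝ) (Icc 0 τ) := by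
    intro z
    have hc := hU.continuousOn s hs hsT.le y z
    refine (hc.comp (continuous_const.add continuous_id).continuousOn ?_)
    intro r hr
    exact ⟨by linarith [hr.1], by rw [hτdef] at hr; linarith [hr.2]⟩
  have hsτ : s + τ = s' := by rw [hτdef]; ring
  have henergy : ‖U s s' y‖ ^ 2 ≤ (Real.exp (-(ρ * τ)) + ε2) * ‖y‖ ^ 2 := by
    set A : ℝ := ‖U s s' y‖ with hAdef
    have hA0 : 0 ≤ A := norm_nonneg _
    set R : ℝ := (Real.exp (-(ρ * τ)) + ε2) * ‖y‖ ^ 2 with hRdef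
    have hR0 : 0 ≤ R := by positivity
    set g : ℝ → ℝ := fun r => Real.sqrt ((Real.exp (-(ρ * r)) + ε2) * ‖y‖ ^ 2) * A with hgdef
    have hgc : ContinuousOn g (Icc 0 τ) := by
      refine ((Real.continuous_sqrt.comp ?_).mul continuous_const).continuousOn
      exact ((Real.continuous_exp.comp (continuous_const.mul continuous_id).neg).add continuous_const).mul continuous_const
    have hfg : ∀ᵐ r ∂(volume.restrict (Ioo 0 τ)), ⟪U s (s + r) y, U s s' y⟫_ℝ ≤ g r := by
      filter_upwards [hgood] with r hr
      obtain ⟨_, _, _, h2⟩ := hr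
      have h1 : ⟪U s (s + r) y, U s s' y⟫_ℝ ≤ ‖U s (s + r) y‖ * A := real_inner_le_norm _ _
      have h3 : ‖U s (s + r) y‖ ≤ Real.sqrt ((Real.exp (-(ρ * r)) + ε2) * ‖y‖ ^ 2) := by
        rw [← Real.sqrt_sq (norm_nonneg _)]; exact Real.sqrt_le_sqrt h2
      exact h1.trans (mul_le_mul_of_nonneg_right h3 hA0)
    have hend := le_on_Icc_of_ae_le_of_continuousOn₂ hτ (hcont _) hgc hfg τ ⟨hτ.le, le_rfl⟩
    have hfτ : ⟪U s (s + τ) y, U s s' y⟫_ℝ = A ^ 2 := by rw [hsτ, hAdef]; exact real_inner_self_eq_norm_sq _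
    simp only [hgdef] at hend
    rw [hfτ] at hend
    rcases hA0.eq_or_lt with hA | hApos
    · rw [← hA]; simpa using hR0
    · have h3 : A ≤ Real.sqrt R := by
        have : A * A ≤ Real.sqrt R * A := by rw [← sq]; exact hend
        exact le_of_mul_le_mul_right this hApos
      calc A ^ 2 ≤ Real.sqrt R ^ 2 := by gcongr
        _ = R := Real.sq_sqrt hR0
  -- ### (i) the low modes at the endpoint, tested against the truncation of `U s s' y`
  set S₀ : Finset (d → ℤ) := FunctionSpaces.Torus.freqBall L' with hS₀
  have hS₀sym : ∀ k ∈ S₀, -k ∈ S₀ := FunctionSpaces.Torus.neg_mem_freqBall_of_mem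
  set u' : UnitAddTorus d → EuclideanSpace ℝ d := ((U s s' y : Lp (EuclideanSpace ℝ d) 2 volume) : UnitAddTorus d → EuclideanSpace ℝ d)
    with hu'
  have hu'm : MemLp u' 2 volume := Lp.memLp _
  set c : (d → ℤ) → EuclideanSpace ℂ d := fun k => mFourierCoeff (FunctionSpaces.EuclideanSpace.complexify ∘ u') k with hc
  have hcsym : FunctionSpaces.Torus.IsConjSymm c := FunctionSpaces.Torus.isConjSymm_mFourierCoeff (hu'm.integrable one_le_two)
  have hzm : MemLp (FunctionSpaces.Torus.realTrigPoly S₀ c) 2 volume := FunctionSpaces.Torus.memLp_realTrigPoly S₀ c 2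
  set z : Lp (EuclideanSpace ℝ d) 2 (volume : Measure (UnitAddTorus d)) := hzm.toLp _ with hz
  set B2 : ℝ := ∑ k ∈ S₀, ‖c k‖ ^ 2 with hB2
  have hB20 : 0 ≤ B2 := Finset.sum_nonneg fun k _ => sq_nonneg _
  have hzn : ‖z‖ ^ 2 = B2 := by
    rw [hz, norm_toLp_sq_eq_integral hzm, FunctionSpaces.Torus.integral_norm_sq_realTrigPoly hS₀sym hcsym]
  -- the pairing `⟪v, z⟫ = Σ_{k∈S₀} Re⟪𝓕v(k), c k⟫` for `v ∈ L²`
  have hpair : ∀ v : Lp (EuclideanSpace ℝ d) 2 (volume : Measure (UnitAddTorus d)),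
      ⟪v, z⟫_ℝ = ∑ k ∈ S₀, (inner ℂ (mFourierCoeff (FunctionSpaces.EuclideanSpace.complexify ∘
        (v : UnitAddTorus d → EuclideanSpace ℝ d)) k) (c k)).re := by
    intro v
    rw [MeasureTheory.L2.inner_def, ← FunctionSpaces.Torus.integral_inner_realTrigPoly_right hS₀sym hcsym (Lp.memLp v)]
    refine integral_congr_ae ?_
    filter_upwards [hzm.coeFn_toLp] with ξ hξ
    rw [hz] ; simp only [hξ]
  have hlow : B2 ≤ ε2 * ‖y‖ ^ 2 := by
    set g : ℝ → ℝ := fun _ => Real.sqrt (ε2 * ‖y‖ ^ 2) * Real.sqrt B2 with hgdef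
    have hgc : ContinuousOn g (Icc 0 τ) := continuousOn_const
    have hfg : ∀ᵐ r ∂(volume.restrict (Ioo 0 τ)), ⟪U s (s + r) y, z⟫_ℝ ≤ g r := by
      filter_upwards [hgood] with r hr
      obtain ⟨hm, he, h1, _⟩ := hr
      rw [hpair]
      -- the Fourier coefficients of `U s (s+r) y` are those of `w r`
      have hae : ((U s (s + r) y : Lp (EuclideanSpace ℝ d) 2 volume) : UnitAddTorus d → EuclideanSpace ℝ d) =ᵐ[volume] w r := by
        rw [← he]; exact hm.coeFn_toLp
      have e2 : ∀ k, mFourierCoeff (FunctionSpaces.EuclideanSpace.complexify ∘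
          ((U s (s + r) y : Lp (EuclideanSpace ℝ d) 2 volume) : UnitAddTorus d → EuclideanSpace ℝ d)) k =
          mFourierCoeff (FunctionSpaces.EuclideanSpace.complexify ∘ w r) k := fun k =>
        FunctionSpaces.Torus.mFourierCoeff_congr_ae (hae.mono fun ξ hξ => by simp only [Function.comp_apply, hξ]) k
      simp_rw [e2]
      calc ∑ k ∈ S₀, (inner ℂ (mFourierCoeff (FunctionSpaces.EuclideanSpace.complexify ∘ w r) k) (c k)).re
          ≤ ∑ k ∈ S₀, ‖mFourierCoeff (FunctionSpaces.EuclideanSpace.complexify ∘ w r) k‖ * ‖c k‖ :=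
            Finset.sum_le_sum fun k _ => (Complex.re_le_norm _).trans (norm_inner_le_norm _ _)
        _ ≤ Real.sqrt (∑ k ∈ S₀, ‖mFourierCoeff (FunctionSpaces.EuclideanSpace.complexify ∘ w r) k‖ ^ 2) * Real.sqrt B2 :=
            Real.sum_mul_le_sqrt_mul_sqrt _ _ _
        _ ≤ Real.sqrt (ε2 * ‖y‖ ^ 2) * Real.sqrt B2 :=
            mul_le_mul_of_nonneg_right (Real.sqrt_le_sqrt h1) (Real.sqrt_nonneg _)
    have hend := le_on_Icc_of_ae_le_of_continuousOn₂ hτ (hcont z) hgc hfg τ ⟨hτ.le, le_rfl⟩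
    have hfτ : ⟪U s (s + τ) y, z⟫_ℝ = B2 := by
      rw [hsτ, hpair, hB2]
      refine Finset.sum_congr rfl fun k _ => ?_
      rw [← @inner_self_eq_norm_sq ℂ]
      rfl
    simp only [hgdef] at hend
    rw [hfτ] at hend
    -- `B2 ≤ √(ε2‖y‖²) √B2` ⇒ `B2 ≤ ε2 ‖y‖²`
    rcases hB20.eq_or_lt with hB | hBpos
    · rw [← hB]; positivity
    · have hsq : Real.sqrt B2 * Real.sqrt B2 = B2 := Real.mul_self_sqrt hB20
      have hspos : 0 < Real.sqrt B2 := Real.sqrt_pos.2 hBpos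
      have h3 : Real.sqrt B2 ≤ Real.sqrt (ε2 * ‖y‖ ^ 2) := by
        have : Real.sqrt B2 * Real.sqrt B2 ≤ Real.sqrt (ε2 * ‖y‖ ^ 2) * Real.sqrt B2 := by rw [hsq]; exact hend
        exact le_of_mul_le_mul_right this hspos
      calc B2 = Real.sqrt B2 * Real.sqrt B2 := hsq.symm
        _ ≤ Real.sqrt (ε2 * ‖y‖ ^ 2) * Real.sqrt (ε2 * ‖y‖ ^ 2) :=
            mul_le_mul h3 h3 (Real.sqrt_nonneg _) (Real.sqrt_nonneg _)
        _ = ε2 * ‖y‖ ^ 2 := Real.mul_self_sqrt (by positivity)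
  refine ⟨hlow, ?_⟩
  rw [hρ, hτdef] at henergy
  exact henergy

/-- **BAND KILL FOR THE WINDOW PROPAGATOR, all `L²` data** (`U` factors through the Leray projection, a contraction
acting modewise): under the hypotheses of `bandKill_of_divFree`, for every `y ∈ L²` whose Fourier coefficients vanish on
the ladder box, (i) `Σ_{|k| ≤ L'} |𝓕(U(s,s′)y)(k)|² ≤ x^{−2(J+1)} ‖y‖²` and (ii)
`‖U(s,s′)y‖² ≤ (e^{−8π² lo L'² (s′−s)} + x^{−2(J+1)}) ‖y‖²`. [cite: Temam1984, Ch. III §1 Lemma 1.2] [cite: DiPernaLions1989, §II.1 Lemma II.1] -/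
theorem bandKill (hU : IsPropagator T b 𝔸 U) (h𝔸 : NearIso 𝔸 lo hi) (hlo : 0 < lo)
    (hb : MemLp (FunctionSpaces.Torus.stLift b) ∞ (volume.restrict (Ioo 0 T ×ˢ univ)))
    (hbdiv : ∀ᵐ τ ∂(volume.restrict (Ioo 0 T)), FunctionSpaces.Torus.IsWeaklyDivFree (b τ))
    (hbc : ∀ᵐ τ ∂(volume.restrict (Ioo 0 T)), Continuous (b τ))
    {Λ : ℝ} (hΛ : 0 ≤ Λ)
    (hbL : ∀ᵐ τ ∂(volume.restrict (Ioo 0 T)), ∀ x y, ‖b τ x - b τ y‖ ≤ Λ * ‖FunctionSpaces.Torus.reprc (x - y)‖)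
    {K₀ S Δ J : ℕ} (hΔ : 0 < Δ) (hS : 2 * Δ ≤ S) (hJ : (J + 1) * S ≤ K₀ + S)
    {W : ℕ → ℝ} (hW0 : ∀ n, 0 ≤ W n)
    (hW : ∀ᵐ τ ∂(volume.restrict (Ioo 0 T)), ∀ n, 1 ≤ n → n ≤ J + 1 → ∀ x,
      ‖b τ x - FunctionSpaces.Torus.fourierTruncate (n * S - 2 * Δ) (b τ) x‖ ≤ W n)
    {s s' x : ℝ} (hs : 0 ≤ s) (hss' : s < s') (hs'T : s' ≤ T) (hx : 1 ≤ x)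
    (hladder : 4 * Real.pi * (K₀ + 2 * Δ) * (s' - s) * x *
      (2 * (Fintype.card d) ^ 2 * Λ / Δ + Fintype.card d * ∑ n ∈ Finset.range (J + 1), W (n + 1) * x ^ (n + 1)) ≤ 1)
    {L' : ℕ} (hL' : L' ≤ FunctionSpaces.Torus.rungHeight K₀ S (J + 1))
    (y : Lp (EuclideanSpace ℝ d) 2 (volume : Measure (UnitAddTorus d)))
    (hyoff : ∀ k ∈ FunctionSpaces.Torus.ladderSupp d K₀ S Δ,
      mFourierCoeff (FunctionSpaces.EuclideanSpace.complexify ∘ (y : UnitAddTorus d → EuclideanSpace ℝ d)) k = 0) :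
    (∑ k ∈ FunctionSpaces.Torus.freqBall L', ‖mFourierCoeff (FunctionSpaces.EuclideanSpace.complexify ∘
        ((U s s' y : Lp (EuclideanSpace ℝ d) 2 volume) : UnitAddTorus d → EuclideanSpace ℝ d)) k‖ ^ 2 ≤
        (x⁻¹ ^ (J + 1)) ^ 2 * ‖y‖ ^ 2) ∧
    ‖U s s' y‖ ^ 2 ≤ (Real.exp (-(8 * Real.pi ^ 2 * lo * (L' : ℝ) ^ 2 * (s' - s))) + (x⁻¹ ^ (J + 1)) ^ 2) * ‖y‖ ^ 2 := by
  set P := (divFreeL2 d).starProjection with hP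
  rw [hU.apply_eq_apply_starProjection s s' y]
  have hPoff : ∀ k ∈ FunctionSpaces.Torus.ladderSupp d K₀ S Δ,
      mFourierCoeff (FunctionSpaces.EuclideanSpace.complexify ∘
        ((P y : Lp (EuclideanSpace ℝ d) 2 (volume : Measure (UnitAddTorus d))) : UnitAddTorus d → EuclideanSpace ℝ d)) k = 0 := by
    intro k hk
    have h1 := norm_mFourierCoeff_starProjection_le y k
    rw [hyoff k hk, norm_zero] at h1
    exact norm_le_zero_iff.1 h1
  have h := hU.bandKill_of_divFree h𝔸 hlo hb hbdiv hbc hΛ hbL hΔ hS hJ hW0 hW hs hss' hs'T hx hladder hL' (P y)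
    (isWeaklyDivFree_starProjection y) hPoff
  have hN : ‖P y‖ ^ 2 ≤ ‖y‖ ^ 2 := pow_le_pow_left₀ (norm_nonneg _) ((divFreeL2 d).norm_starProjection_apply_le y) 2
  have hε : 0 ≤ (x⁻¹ ^ (J + 1)) ^ 2 := sq_nonneg _
  have hc : 0 ≤ Real.exp (-(8 * Real.pi ^ 2 * lo * (L' : ℝ) ^ 2 * (s' - s))) + (x⁻¹ ^ (J + 1)) ^ 2 := by positivity
  exact ⟨h.1.trans (mul_le_mul_of_nonneg_left hN hε), h.2.trans (mul_le_mul_of_nonneg_left hN hc)⟩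

end IsPropagator

end Torus

end Literature.Analysis.FluidPDE

end
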